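import Summits.KontsevichZagierPeriods.KontsevichZagierPeriods.Theorems.KzOnePeriodsG2SDerivation

/-!
# G2S derivations, part 15: three-term (R1) linearity with explicit rows

Sub-problem `KzOnePeriods` ([cite: HuberWustholz2022, Thm 13.3 (2) p.121]); helper lane of the
kz1p derivation modules (cell pub-kz1p, seat 2, gen 24).  A convenience form of part 3's
`span_relation_closed` / `relation_closed` for the generated shape (U) files (kz1p cases G2-12,
G2-13): three forms `π₀ dx/2y, π₁ dx/2y, π₂ dx/2y` given as SEPARATE coefficient vectors and three
scalar coefficients `α₀, α₁, α₂ ∈ ℚ̄` with `α₀π₀ + α₁π₁ + α₂π₂ = 0` coefficientwise give, along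
every closed `C¹` path `γ` on `C`, the derivation `α₀•(C, θ_{π₀}, γ) + α₁•(C, θ_{π₁}, γ) +
α₂•(C, θ_{π₂}, γ) ∈ span((R1)–(R5))` ((R1) linearity, with the trivial exact part `R = 0 = d(0·y)`)
and the period identity `α₀∫_γ π₀ dx/2y + α₁∫_γ π₁ dx/2y + α₂∫_γ π₂ dx/2y = 0`
[cite: HuberWustholz2022, §13.1 (A)–(B) p.120].  Stated without `Fin 3`-indexed matrices so that
the per-case files can combine it with the pull-back and unit identities by `linear_combination`.

No new axioms; no statements of the programme are cited.
-/

noncomputable section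

open MvPolynomial Set Complex
open Literature.NumberTheory.Transcendental Literature.NumberTheory.Transcendental.CurvePeriods
open Summit.KontsevichZagierPeriods.KzOnePeriods.E1Derivation

namespace Summit.KontsevichZagierPeriods.KzOnePeriods.G2SDerivation

local notation3 "InSpanRel " c:arg => ∃ (k : ℕ) (ρ : Fin k → (PeriodSymbol →₀ ℂ))
  (a : Fin k → ℂ), (∀ l, IsElementaryRelation (ρ l)) ∧ (∀ l, IsAlgebraic ℚ (a l)) ∧
    c = ∑ l, a l • ρ l

local notation3 (prettyPrint := false) "Sy[" Z ", " hZ ", " ω ", " h ", " γ "]" =>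
  (Finsupp.single (⟨Z, hZ, ω, h, γ⟩ : PeriodSymbol) (1 : ℂ) : PeriodSymbol →₀ ℂ)

local notation3 (prettyPrint := false) "Pe[" Z ", " hZ ", " ω ", " h ", " γ "]" =>
  PeriodSymbol.period (⟨Z, hZ, ω, h, γ⟩ : PeriodSymbol)

local notation3 (prettyPrint := false) "fS[" a ", " b ", " c "]" =>
  ((X 0 : MvPolynomial (Fin 2) ℂ) ^ 6 + C a * X 0 ^ 4 + C b * X 0 ^ 2 + C c)

local notation3 (prettyPrint := false) "Cpl[" a ", " b ", " c "]" =>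
  (⟨2, 1, ![(X 1 : MvPolynomial (Fin 2) ℂ) ^ 2 - fS[a, b, c]]⟩ : CurveData)

local notation3 (prettyPrint := false) "Pol[" π "]" =>
  (∑ k, C (π k) * (X 0 : MvPolynomial (Fin 2) ℂ) ^ (k : ℕ))

local notation3 (prettyPrint := false) "Upol[" μ "]" =>
  (∑ k : Fin 3, C (μ k) * (X 0 : MvPolynomial (Fin 2) ℂ) ^ (2 * (k : ℕ)))

local notation3 (prettyPrint := false) "Vpol[" ν "]" =>
  (∑ k : Fin 3, C (ν k) * (X 0 : MvPolynomial (Fin 2) ℂ) ^ (2 * (k : ℕ) + 1))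

local notation3 (prettyPrint := false) "θ[" μ ", " ν ", " π "]" =>
  (![C (1 / 2 : ℂ) * Pol[π] * Upol[μ] * X 1, Pol[π] * Vpol[ν]] :
    Fin 2 → MvPolynomial (Fin 2) ℂ)

local notation3 (prettyPrint := false) "Bez[" a ", " b ", " c ", " μ ", " ν "]" =>
  (∀ x : ℂ, (∑ k : Fin 3, μ k * x ^ (2 * (k : ℕ))) * (x ^ 6 + a * x ^ 4 + b * x ^ 2 + c) +
    (∑ k : Fin 3, ν k * x ^ (2 * (k : ℕ) + 1)) * (6 * x ^ 5 + 4 * a * x ^ 3 + 2 * b * x) = 1)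

local notation3 (prettyPrint := false) "Red[" a ", " b ", " c ", " ρ ", " e "]" =>
  (∀ x : ℂ, ∑ k, ρ k * x ^ (k : ℕ) =
    2 * (∑ j, e j * ((j : ℕ) : ℂ) * x ^ ((j : ℕ) - 1)) * (x ^ 6 + a * x ^ 4 + b * x ^ 2 + c) +
      (∑ j, e j * x ^ (j : ℕ)) * (6 * x ^ 5 + 4 * a * x ^ 3 + 2 * b * x))

variable {a b c : ℂ}

/-- The data of `span_relation_closed` for three explicit rows: algebraicity of the packed
coefficient vector / matrix, the packed linear constraint with `R = 0`, and the trivial exactness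
datum `0 = d(0·y)`. -/
theorem lin3_data {N : ℕ} {π₀ π₁ π₂ : Fin N → ℂ} (h₀ : ∀ k, IsAlgebraic ℚ (π₀ k))
    (h₁ : ∀ k, IsAlgebraic ℚ (π₁ k)) (h₂ : ∀ k, IsAlgebraic ℚ (π₂ k)) {α₀ α₁ α₂ : ℂ}
    (hα₀ : IsAlgebraic ℚ α₀) (hα₁ : IsAlgebraic ℚ α₁) (hα₂ : IsAlgebraic ℚ α₂)
    (hlin : ∀ k, α₀ * π₀ k + α₁ * π₁ k + α₂ * π₂ k = 0) :
    (∀ i, IsAlgebraic ℚ ((![α₀, α₁, α₂] : Fin 3 → ℂ) i)) ∧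
    (∀ i k, IsAlgebraic ℚ ((![π₀, π₁, π₂] : Fin 3 → Fin N → ℂ) i k)) ∧
    (∀ k, IsAlgebraic ℚ ((fun _ : Fin N => (0 : ℂ)) k)) ∧
    (∀ k, (fun _ : Fin N => (0 : ℂ)) k = ∑ i, (![α₀, α₁, α₂] : Fin 3 → ℂ) i *
        (![π₀, π₁, π₂] : Fin 3 → Fin N → ℂ) i k) ∧
    (∀ j, IsAlgebraic ℚ ((![0] : Fin 1 → ℂ) j)) ∧ Red[a, b, c, (fun _ : Fin N => (0 : ℂ)), (![0] : Fin 1 → ℂ)] := by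
  refine ⟨fun i => ?_, fun i k => ?_, fun _ => isAlgebraic_zero, fun k => ?_, fun j => ?_, fun x => ?_⟩
  · fin_cases i
    exacts [hα₀, hα₁, hα₂]
  · fin_cases i
    exacts [h₀ k, h₁ k, h₂ k]
  · rw [Fin.sum_univ_three]
    simp only [Matrix.cons_val_zero, Matrix.cons_val_one, Matrix.cons_val_two, Matrix.head_cons,
      Matrix.tail_cons]
    exact (hlin k).symm
  · rw [Matrix.cons_val_fin_one]
    exact isAlgebraic_zero
  · simp

/-- **(R1) with three explicit rows, derivation**: `α₀π₀ + α₁π₁ + α₂π₂ = 0` coefficientwise gives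
`α₀•(C, θ_{π₀}, γ) + α₁•(C, θ_{π₁}, γ) + α₂•(C, θ_{π₂}, γ) ∈ span((R1)–(R5))` along every closed
`C¹` path `γ` on `C` [cite: HuberWustholz2022, §13.1 (A)–(B) p.120]. -/
theorem span_lin3 (ha : IsAlgebraic ℚ a) (hb : IsAlgebraic ℚ b) (hc : IsAlgebraic ℚ c)
    {μ ν : Fin 3 → ℂ} (hμ : ∀ k, IsAlgebraic ℚ (μ k)) (hν : ∀ k, IsAlgebraic ℚ (ν k))
    (hbez : Bez[a, b, c, μ, ν]) {N : ℕ} {π₀ π₁ π₂ : Fin N → ℂ} (h₀ : ∀ k, IsAlgebraic ℚ (π₀ k))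
    (h₁ : ∀ k, IsAlgebraic ℚ (π₁ k)) (h₂ : ∀ k, IsAlgebraic ℚ (π₂ k)) {α₀ α₁ α₂ : ℂ}
    (hα₀ : IsAlgebraic ℚ α₀) (hα₁ : IsAlgebraic ℚ α₁) (hα₂ : IsAlgebraic ℚ α₂)
    (hlin : ∀ k, α₀ * π₀ k + α₁ * π₁ k + α₂ * π₂ k = 0)
    {γ : CurvePath Cpl[a, b, c]} (hγ : γ.toFun 1 = γ.toFun 0) :
    InSpanRel (α₀ • Sy[Cpl[a, b, c], smooth ha hb hc hbez, θ[μ, ν, π₀], hasAlgCoeffs_theta hμ hν h₀, γ] +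
      α₁ • Sy[Cpl[a, b, c], smooth ha hb hc hbez, θ[μ, ν, π₁], hasAlgCoeffs_theta hμ hν h₁, γ] +
      α₂ • Sy[Cpl[a, b, c], smooth ha hb hc hbez, θ[μ, ν, π₂], hasAlgCoeffs_theta hμ hν h₂, γ]) := by
  obtain ⟨hα, hπ, hρ, hlin', he, hD⟩ := lin3_data (a := a) (b := b) (c := c) h₀ h₁ h₂ hα₀ hα₁ hα₂ hlin
  have h := span_relation_closed ha hb hc hμ hν hbez hα hπ hρ hlin' he hD hγ
  rw [Fin.sum_univ_three] at h
  simpa only [Matrix.cons_val_zero, Matrix.cons_val_one, Matrix.cons_val_two, Matrix.head_cons,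
    Matrix.tail_cons] using h

/-- **(R1) with three explicit rows, period identity**:
`α₀∫_γ π₀ dx/2y + α₁∫_γ π₁ dx/2y + α₂∫_γ π₂ dx/2y = 0` along every closed `C¹` path `γ` on `C`
[cite: HuberWustholz2022, §13.1 (A)–(B) p.120, Thm 13.3 (2) p.121]. -/
theorem relation_lin3 (ha : IsAlgebraic ℚ a) (hb : IsAlgebraic ℚ b) (hc : IsAlgebraic ℚ c)
    {μ ν : Fin 3 → ℂ} (hμ : ∀ k, IsAlgebraic ℚ (μ k)) (hν : ∀ k, IsAlgebraic ℚ (ν k))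
    (hbez : Bez[a, b, c, μ, ν]) {N : ℕ} {π₀ π₁ π₂ : Fin N → ℂ} (h₀ : ∀ k, IsAlgebraic ℚ (π₀ k))
    (h₁ : ∀ k, IsAlgebraic ℚ (π₁ k)) (h₂ : ∀ k, IsAlgebraic ℚ (π₂ k)) {α₀ α₁ α₂ : ℂ}
    (hα₀ : IsAlgebraic ℚ α₀) (hα₁ : IsAlgebraic ℚ α₁) (hα₂ : IsAlgebraic ℚ α₂)
    (hlin : ∀ k, α₀ * π₀ k + α₁ * π₁ k + α₂ * π₂ k = 0)
    {γ : CurvePath Cpl[a, b, c]} (hγ : γ.toFun 1 = γ.toFun 0) :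
    α₀ * Pe[Cpl[a, b, c], smooth ha hb hc hbez, θ[μ, ν, π₀], hasAlgCoeffs_theta hμ hν h₀, γ] +
      α₁ * Pe[Cpl[a, b, c], smooth ha hb hc hbez, θ[μ, ν, π₁], hasAlgCoeffs_theta hμ hν h₁, γ] +
      α₂ * Pe[Cpl[a, b, c], smooth ha hb hc hbez, θ[μ, ν, π₂], hasAlgCoeffs_theta hμ hν h₂, γ] = 0 := by
  obtain ⟨hα, hπ, hρ, hlin', he, hD⟩ := lin3_data (a := a) (b := b) (c := c) h₀ h₁ h₂ hα₀ hα₁ hα₂ hlin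
  have h := relation_closed ha hb hc hμ hν hbez hα hπ hρ hlin' he hD hγ
  rw [Fin.sum_univ_three] at h
  simpa only [Matrix.cons_val_zero, Matrix.cons_val_one, Matrix.cons_val_two, Matrix.head_cons,
    Matrix.tail_cons] using h

end Summit.KontsevichZagierPeriods.KzOnePeriods.G2SDerivation
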